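import Literature.Geometry.Kaehler.ComplexTorusFibrationTorsionReadings
import Literature.AlgebraicGeometry.Motives.ComplexPointsEhresmann
import Literature.AlgebraicGeometry.Motives.ComplexPointsManifold
import Literature.AlgebraicGeometry.HodgeTheory.DirectImageTransport
import Literature.AlgebraicGeometry.HodgeTheory.GlobalInvariantCyclesProofs
import Literature.AlgebraicGeometry.HodgeTheory.HyperplaneSectionMonodromyTrivialisations
import Literature.AlgebraicGeometry.Motives.PeriodRealizationClassical
import HarnessLib

/-!
# Torsion sections of a smooth proper family with torus-charted fibres have FLAT lattice readings

Layer `Literature/AlgebraicGeometry/HodgeTheory`, namespace `Literature.AlgebraicGeometry.HodgeTheory`.  THEOREMS ONLY (no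
definition, no named fact, no instance).  Leaf (E3) = the scheme-side wrapper of the cell `hodgecm-mathlib` (U)-lane engine
(E2-core) «torsion readings against a flat frame are constant» (node U-e P4, composite (B2); road (b-H′): markings built
POINTWISE, only DISCRETE data transported), stated NOTION-FREE (the consumer's `SiegelMarkingFamily` / `IsMarkingFrame` /
`IsFlatIntegralFrame` unfold to the hypotheses below, P4 lead's glue by `fun h ↦ h`).

SETTING.  `f : 𝒳 → S` smooth proper of relative dimension `d` over a smooth separated `ℂ`-scheme `S` of dimension `m` (so that
Ehresmann's theorem ★ `Motives.ComplexPoints.isLocallyTrivialFibration_map_of_smoothOfRelativeDimension` applies to `f(ℂ)`),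
`W ⊆ S(ℂ)` path connected and cohomologically locally trivial (★ `IsCohomologicallyLocallyTrivialOn`; ★ `transportFun`).  Over each
`x ∈ W` the fibre `X_x(ℂ)` is CHARTED by a torus `u x : (ℝ/ℤ)^ι → X_x(ℂ)` (a bijective continuous map — for U-e: the marking's
uniformisation followed by the fibre identification; NO continuity in `x`), FRAMED by classes `γ x a ∈ H¹(X_x(ℂ); ℚ)` which are
FLAT (`transportFun` carries `γ x a ⊗ 1` to `γ x' a ⊗ 1` along every path in `W` — clause (iii) of `IsFlatIntegralFrame`) and are
the charts' canonical classes (`(u x)^* γ x a = ξₐ` — `IsMarkingFrame`); an endomorphism `nX` of `𝒳` over `S` is multiplication by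
`N` in the charts (`hpow`), and `τ` is a continuous section of `f(ℂ)` over `W` which in the chart at `x` is the `N`-torsion point
`[w(x)/N]` (the reference section `[N] ∘ τ` — the charts' origins — is then continuous for free).

THEOREM `torsionReading_const_of_flatFrame`: **`w(x) ≡ w(x′) (mod N)` on `W`.**  Locally this is ★
`ComplexTorus.torsionReading_eq_of_trivialisation` (E2) on an Ehresmann chart shrunk to a contractible open inside a cohomologically
trivialising open (★ `exists_isOpen_contractibleSpace_of_chartedSpace`), the global classes being the TUBE classes of the flat frame
(★ `IsCohomologicallyLocallyTrivialOn.exists_nhds_bijective` + ★ `transportFun_fiberRestrict`, coefficients moved `ℚ → ℂ` by ★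
`ofRatClass_map`); globally, a locally constant function on the connected `W` is constant.
HC_CM is proved only modulo the 7 printed citations until rung 0 closes.

## References
* [VoisinHodgeI2002] C. Voisin, *Hodge Theory and Complex Algebraic Geometry I*, CUP 2002, §9.1.1 Thm. 9.3, §9.2.1 (pp. 220–231).
* [Lange2023AbelianVarietiesComplex] H. Lange, *Abelian Varieties over the Complex Numbers* (2023), §1.1.3 Lemma 1.1.17 (a) (p. 14).
* [LangeBirkenhake1992] H. Lange, Ch. Birkenhake, *Complex Abelian Varieties* (1992), Ch. 8 §8.1.
* [HatcherAT2002] A. Hatcher, *Algebraic Topology*, CUP 2002, §3.1 p. 198.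
-/

noncomputable section

open Set Function unitInterval Topology Filter CategoryTheory AlgebraicGeometry
open Literature.AlgebraicTopology.SingularHomology
open Literature.AlgebraicGeometry.Motives (AlgPoints ComplexPoints fiberOver fiberι)
open Literature.Geometry.Kaehler (ComplexTorus)

namespace Literature.AlgebraicGeometry.HodgeTheory

/-- **`θ_ℚ ⊗ 1 = θ_ℂ`**: change of coefficients carries the rational generator of `H¹(ℝ/ℤ)` to the complex one (both are the class of
the integral winding cocycle). [cite: HatcherAT2002, §3.1 p. 198] -/
theorem ofRatClass_circleClass : ofRatClass UnitAddCircle 1 (circleClass ℚ) = circleClass ℂ := by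
  rw [circleClass, circleClass, ofRatClass_π]
  congr 1
  refine singularCochainComplex.cocycles_ext ?_
  rw [cocycleOfRat_eq_coeffCocycle, iCocycles_coeffCocycle, iCocycles_circleCocycle, iCocycles_circleCocycle]
  refine singularCochainComplex.ext fun c ↦ ?_
  rw [coeffCochain_apply, circleCochain_apply, circleCochain_apply]
  simp

section Main

variable {𝒳 S : Motives.SchemeOver ℂ} (f : 𝒳 ⟶ S)

/-- **TORSION SECTIONS HAVE FLAT LATTICE READINGS** ((E2-core), notion-free).  See the module docstring for the setting; the
conclusion `w(x) ≡ w(x′) (mod N)` says: the lattice coordinates (in the flat frame) of a continuous `N`-torsion section of a smooth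
proper family of torus-uniformised fibres are constant on a path-connected cohomologically locally trivial `W`.
[cite: VoisinHodgeI2002, §9.2.1 (pp. 229–231)] [cite: LangeBirkenhake1992, Ch. 8 §8.1] -/
theorem torsionReading_const_of_flatFrame (d m : ℕ) [LocallyOfFiniteType 𝒳.hom] [LocallyOfFiniteType S.hom]
    [SmoothOfRelativeDimension m S.hom] [SmoothOfRelativeDimension d f.left] [IsProper f.left]
    [IsSeparated 𝒳.hom] [IsSeparated S.hom]
    [SecondCountableTopology (ComplexPoints 𝒳)] [SecondCountableTopology (ComplexPoints S)]
    {W : Set (ComplexPoints S)} (hW : IsPathConnected W) (hU : IsCohomologicallyLocallyTrivialOn f W)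
    {ι : Type} [Fintype ι] {V : Type} [NormedAddCommGroup V] [NormedSpace ℂ V] (Ψ : (ι → ℝ) ≃L[ℝ] V)
    (u : ∀ x : W, C(ComplexTorus Ψ, ComplexPoints (fiberOver f x.1))) (hu : ∀ x, Function.Bijective (u x))
    (γ : ∀ x : W, ι → singularCohomology ℚ ℚ (ComplexPoints (fiberOver f x.1)) 1)
    (hγ : ∀ (x x' : W) (q : Path.Homotopic.Quotient x x') (a : ι),
      transportFun f 1 hU q (ofRatClass _ 1 (γ x a)) = ofRatClass _ 1 (γ x' a))
    (hframe : ∀ (x : W) (a : ι), singularCohomology.map ℚ ℚ (u x) 1 (γ x a) = latticeClass Ψ a)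
    (N : ℕ) (hN : 0 < N) (nX : 𝒳 ⟶ 𝒳) (hnX : nX ≫ f = f)
    (hpow : ∀ (x : W) (t : ComplexTorus Ψ),
      AlgPoints.map nX (AlgPoints.map (fiberι f x.1) (u x t)) = AlgPoints.map (fiberι f x.1) (u x (N • t)))
    (τ : W → ComplexPoints 𝒳) (hτ : Continuous τ) (w : W → ι → ℤ)
    (hτw : ∀ x, τ x = AlgPoints.map (fiberι f x.1) (u x (ComplexTorus.proj Ψ fun i ↦ (w x i : ℝ) / N)))
    (x x' : W) (a : ι) : (w x a : ZMod N) = (w x' a : ZMod N) := by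
  classical
  haveI : PreconnectedSpace W := Subtype.preconnectedSpace hW.isConnected.isPreconnected
  haveI : T2Space (ComplexPoints 𝒳) := Motives.ComplexPoints.t2Space_of_isSeparated 𝒳
  -- Ehresmann: `f(ℂ)` is a locally trivial fibration
  have hEhr := Motives.ComplexPoints.isLocallyTrivialFibration_map_of_smoothOfRelativeDimension d m f
  suffices hlc : IsLocallyConstant (fun x : W ↦ (w x a : ZMod N)) from hlc.apply_eq_of_preconnectedSpace x x'
  refine (IsLocallyConstant.iff_eventually_eq _).2 fun x₁ ↦ ?_
  /- Step 1: an Ehresmann chart `Vt ∋ x₁`, a cohomologically trivialising open `B ⊆ Vt ∩ W`, a contractible open `O ∋ x₁` in `B`. -/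
  obtain ⟨Vt, hVo, hx₁V, φ, hφ⟩ := hEhr x₁.1
  obtain ⟨B, hBo, hx₁B, hBV, hBW, hbij⟩ := hU.exists_nhds_bijective x₁.2 Vt (hVo.mem_nhds hx₁V)
  letI := Motives.ComplexPoints.chartedSpace S m
  obtain ⟨O, hOo, hx₁O, hOB, hOc⟩ :=
    exists_isOpen_contractibleSpace_of_chartedSpace (d := 2 * m) x₁.1 B (hBo.mem_nhds hx₁B)
  haveI : ContractibleSpace O := hOc
  have hOW : O ⊆ W := hOB.trans hBW
  have hOV : O ⊆ Vt := hOB.trans hBV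
  -- points of `W` and of `O`
  let toW : O → W := fun o ↦ ⟨o.1, hOW o.2⟩
  have htoW : Continuous toW := continuous_subtype_val.subtype_mk _
  /- Step 2: the data of ★ `ComplexTorus.torsionReading_eq_of_trivialisation` over the base `O`. -/
  -- total space: the tube over `O`; projection
  let Et : Type := ↥(tubeOver f O)
  let pO : Et → O := fun P ↦ ⟨AlgPoints.map f P.1, P.2⟩
  -- the trivialisation, restricted from `Vt` to `O`
  have hφ_fst : ∀ Q : ↥((AlgPoints.map f : ComplexPoints 𝒳 → ComplexPoints S) ⁻¹' Vt),
      ((φ.symm Q).1 : ComplexPoints S) = AlgPoints.map f Q.1 := fun Q ↦ by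
    have h := hφ (φ.symm Q)
    rw [φ.apply_symm_apply] at h
    exact h.symm
  have htrivmem : ∀ y : ↥O × ↥((AlgPoints.map f : ComplexPoints 𝒳 → ComplexPoints S) ⁻¹' {x₁.1}),
      ((φ (⟨y.1.1, hOV y.1.2⟩, y.2)).1 : ComplexPoints 𝒳) ∈ tubeOver f O := fun y ↦ by
    change AlgPoints.map f _ ∈ O
    rw [hφ]
    exact y.1.2
  have hOVmem : ∀ y : ↥O × ↥((AlgPoints.map f : ComplexPoints 𝒳 → ComplexPoints S) ⁻¹' {x₁.1}),
      (y.1.1 : ComplexPoints S) ∈ Vt := fun y ↦ hOV y.1.2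
  have hPVt : ∀ P : Et, (P.1 : ComplexPoints 𝒳) ∈ (AlgPoints.map f : ComplexPoints 𝒳 → ComplexPoints S) ⁻¹' Vt :=
    fun P ↦ hOV P.2
  let triv : ↥O × ↥((AlgPoints.map f : ComplexPoints 𝒳 → ComplexPoints S) ⁻¹' {x₁.1}) ≃ₜ Et :=
    { toFun := fun y ↦ ⟨(φ (⟨y.1.1, hOV y.1.2⟩, y.2)).1, htrivmem y⟩
      invFun := fun P ↦ (⟨AlgPoints.map f P.1, P.2⟩, (φ.symm ⟨P.1, hOV P.2⟩).2)
      left_inv := fun y ↦ by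
        obtain ⟨o, z⟩ := y
        have h1 : (⟨(φ (⟨o.1, hOV o.2⟩, z)).1, hOV (by change AlgPoints.map f _ ∈ O; rw [hφ]; exact o.2)⟩ :
            ↥((AlgPoints.map f : ComplexPoints 𝒳 → ComplexPoints S) ⁻¹' Vt)) = φ (⟨o.1, hOV o.2⟩, z) := Subtype.ext rfl
        refine Prod.ext (Subtype.ext ?_) ?_
        · change AlgPoints.map f (φ (⟨o.1, hOV o.2⟩, z)).1 = o.1
          rw [hφ]
        · change (φ.symm ⟨(φ (⟨o.1, hOV o.2⟩, z)).1, _⟩).2 = z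
          rw [h1, φ.symm_apply_apply]
      right_inv := fun P ↦ by
        refine Subtype.ext ?_
        change (φ (⟨AlgPoints.map f P.1, hOV P.2⟩, (φ.symm ⟨P.1, hOV P.2⟩).2)).1 = P.1
        have h1 : (⟨AlgPoints.map f P.1, hOV P.2⟩ : ↥Vt) = (φ.symm ⟨P.1, hOV P.2⟩).1 :=
          Subtype.ext (hφ_fst ⟨P.1, hOV P.2⟩).symm
        rw [h1, Prod.mk.eta, φ.apply_symm_apply]
      continuous_toFun := (continuous_subtype_val.comp (φ.continuous.comp
        (((continuous_subtype_val.comp continuous_fst).subtype_mk hOVmem).prodMk continuous_snd))).subtype_mk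
          htrivmem
      continuous_invFun :=
        (((Motives.AlgPoints.continuous_map f).comp continuous_subtype_val).subtype_mk fun P : Et ↦ P.2).prodMk
          (continuous_snd.comp (φ.symm.continuous.comp (continuous_subtype_val.subtype_mk hPVt))) }
  have htriv : ∀ y, pO (triv y) = y.1 := fun y ↦ by
    refine Subtype.ext ?_
    change AlgPoints.map f (φ (⟨y.1.1, hOV y.1.2⟩, y.2)).1 = y.1.1
    rw [hφ]
  -- fibre charts into the tube
  have huOmem : ∀ (o : O) (t : ComplexTorus Ψ), AlgPoints.map (fiberι f o.1) (u (toW o) t) ∈ tubeOver f O := fun o t ↦ by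
    change AlgPoints.map f _ ∈ O
    rw [Motives.AlgPoints.map_map_fiberι]
    exact o.2
  let uO : O → C(ComplexTorus Ψ, Et) := fun o ↦ ⟨fun t ↦ ⟨AlgPoints.map (fiberι f o.1) (u (toW o) t), huOmem o t⟩,
    ((Motives.AlgPoints.continuous_map _).comp (u (toW o)).continuous).subtype_mk (huOmem o)⟩
  have hpu : ∀ o t, pO (uO o t) = o := fun o t ↦ Subtype.ext (Motives.AlgPoints.map_map_fiberι f o.1 _)
  have hinj : ∀ o, Function.Injective (uO o) := fun o t t' h ↦
    (hu (toW o)).1 (Motives.AlgPoints.map_fiberι_injective f o.1 (congrArg Subtype.val h))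
  have hsurj : ∀ o (P : Et), pO P = o → ∃ t, uO o t = P := fun o P hP ↦ by
    have hP' : P.1 ∈ (AlgPoints.map f : ComplexPoints 𝒳 → ComplexPoints S) ⁻¹' {o.1} := by
      change AlgPoints.map f P.1 = o.1
      exact congrArg Subtype.val hP
    rw [← Motives.AlgPoints.range_map_fiberι] at hP'
    obtain ⟨Q, hQ⟩ := hP'
    obtain ⟨t, ht⟩ := (hu (toW o)).2 Q
    exact ⟨t, Subtype.ext (by change AlgPoints.map (fiberι f o.1) (u (toW o) t) = P.1; rw [ht, hQ])⟩
  -- multiplication by `N`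
  have hnEmem : ∀ P : Et, AlgPoints.map nX P.1 ∈ tubeOver f O := fun P ↦ by
    change AlgPoints.map f (AlgPoints.map nX P.1) ∈ O
    rw [← Motives.AlgPoints.map_comp_apply, hnX]
    exact P.2
  let nE : C(Et, Et) := ⟨fun P ↦ ⟨AlgPoints.map nX P.1, hnEmem P⟩,
    ((Motives.AlgPoints.continuous_map nX).comp continuous_subtype_val).subtype_mk hnEmem⟩
  have hnE : ∀ o t, nE (uO o t) = uO o (N • t) := fun o t ↦ Subtype.ext (hpow (toW o) t)
  -- the tube classes of the flat frame (coefficients `ℂ`)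
  have hsurjB : ∀ a', ∃ Ξ : singularCohomology ℂ ℂ (tubeOver f B) 1,
      fiberRestrict f hx₁B 1 Ξ = ofRatClass _ 1 (γ x₁ a') := fun a' ↦ (hbij 1 hx₁B).2 _
  choose ΞB hΞB using hsurjB
  have hinclO : ∀ P : Et, (P.1 : ComplexPoints 𝒳) ∈ tubeOver f B := fun P ↦ by
    change AlgPoints.map f P.1 ∈ B; exact hOB P.2
  let inclO : C(Et, tubeOver f B) := ⟨fun P ↦ ⟨P.1, hinclO P⟩, continuous_subtype_val.subtype_mk hinclO⟩
  let Ξ : ι → singularCohomology ℂ ℂ Et 1 := fun a' ↦ singularCohomology.map ℂ ℂ inclO 1 (ΞB a')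
  have hΞ : ∀ (o : O) (a' : ι), singularCohomology.map ℂ ℂ (uO o) 1 (Ξ a') =
      singularCohomology.map ℂ ℂ (latticeCircle Ψ a') 1 (circleClass ℂ) := by
    intro o a'
    -- flatness along a path in `O` from `x₁` to `o`
    have hoB : (o : ComplexPoints S) ∈ B := hOB o.2
    let po : Path (⟨x₁.1, hx₁O⟩ : O) o := PathConnectedSpace.somePath _ _
    let pW : Path x₁ (toW o) := po.map htoW
    have hpW : ∀ s, (pW s).1 ∈ B := fun s ↦ hOB (po s).2
    have hflat : fiberRestrict f hoB 1 (ΞB a') = ofRatClass _ 1 (γ (toW o) a') := by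
      rw [← transportFun_fiberRestrict f 1 hU hBo pW hpW hx₁B hoB (ΞB a'), hΞB, hγ]
    -- `uO o = inclO⁻¹-tube inclusion ∘ fiberToTube ∘ u`, so pull back in stages
    have hcomp : (inclO.comp (uO o) : C(ComplexTorus Ψ, tubeOver f B)) = (fiberToTube f hoB).comp (u (toW o)) := by
      ext t
      rfl
    calc singularCohomology.map ℂ ℂ (uO o) 1 (Ξ a')
        = singularCohomology.map ℂ ℂ (inclO.comp (uO o)) 1 (ΞB a') := by
          change singularCohomology.map ℂ ℂ (uO o) 1 (singularCohomology.map ℂ ℂ inclO 1 (ΞB a')) = _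
          rw [singularCohomology.map_comp]
          rfl
      _ = singularCohomology.map ℂ ℂ (u (toW o)) 1 (fiberRestrict f hoB 1 (ΞB a')) := by
          rw [hcomp, fiberRestrict, singularCohomology.map_comp]
          rfl
      _ = ofRatClass _ 1 (singularCohomology.map ℚ ℚ (u (toW o)) 1 (γ (toW o) a')) := by
          rw [hflat, Motives.ofRatClass_map]
      _ = singularCohomology.map ℂ ℂ (latticeCircle Ψ a') 1 (circleClass ℂ) := by
          rw [hframe, latticeClass, Motives.ofRatClass_map, ofRatClass_circleClass]
  -- `τ` over `O`, and the zero section `z := [N] ∘ τ` (continuous because `τ` and `[N]` are)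
  have hτmem : ∀ o : O, τ (toW o) ∈ tubeOver f O := fun o ↦ by
    change AlgPoints.map f (τ (toW o)) ∈ O
    rw [hτw, Motives.AlgPoints.map_map_fiberι]
    exact o.2
  let τO : C(O, Et) := ⟨fun o ↦ ⟨τ (toW o), hτmem o⟩, (hτ.comp htoW).subtype_mk hτmem⟩
  have hτO : ∀ o, τO o = uO o (ComplexTorus.proj Ψ fun i ↦ ((w (toW o) i : ℝ)) / N) := fun o ↦
    Subtype.ext (hτw (toW o))
  let z : C(O, Et) := nE.comp τO
  have hz : ∀ o, z o = uO o 0 := fun o ↦ by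
    change nE (τO o) = uO o 0
    rw [hτO, hnE, ComplexTorus.nsmul_proj_div_eq_zero Ψ N hN]
  /- Step 3: apply the topological engine over `O`. -/
  have key : ∀ o o' : O, (w (toW o) a : ZMod N) = (w (toW o') a : ZMod N) := fun o o' ↦
    ComplexTorus.torsionReading_eq_of_trivialisation Ψ ℂ pO triv htriv uO hpu hinj hsurj N hN nE hnE Ξ hΞ z hz τO
      (fun o ↦ w (toW o)) hτO o o' a
  /- Step 4: near `x₁` in `W` every point lies in `O`. -/
  have hmem : ∀ᶠ y : W in 𝓝 x₁, y.1 ∈ O :=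
    (continuous_subtype_val.continuousAt).preimage_mem_nhds (hOo.mem_nhds hx₁O)
  filter_upwards [hmem] with y hy
  have h := key ⟨y.1, hy⟩ ⟨x₁.1, hx₁O⟩
  exact h

/-- **Family version of `torsionReading_const_of_flatFrame`**: the complex structures `Ψ x` of the charts may vary with `x`
(as they do for a family of markings); the underlying real torus does not — `ComplexTorus (Ψ x)` is the type `ι → ℝ/ℤ` for
every `x`, so this is the previous theorem read through that definitional identification (the consumer's `IsMarkingFrame`
clause is stated with `latticeClass (Ψ x)`). [cite: VoisinHodgeI2002, §9.2.1 (pp. 229–231)] [cite: LangeBirkenhake1992, Ch. 8 §8.1] -/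
theorem torsionReading_const_of_flatFrame_family (d m : ℕ) [LocallyOfFiniteType 𝒳.hom] [LocallyOfFiniteType S.hom]
    [SmoothOfRelativeDimension m S.hom] [SmoothOfRelativeDimension d f.left] [IsProper f.left]
    [IsSeparated 𝒳.hom] [IsSeparated S.hom]
    [SecondCountableTopology (ComplexPoints 𝒳)] [SecondCountableTopology (ComplexPoints S)]
    {W : Set (ComplexPoints S)} (hW : IsPathConnected W) (hU : IsCohomologicallyLocallyTrivialOn f W)
    {ι : Type} [Fintype ι] {V : Type} [NormedAddCommGroup V] [NormedSpace ℂ V] (Ψ : W → ((ι → ℝ) ≃L[ℝ] V))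
    (u : ∀ x : W, C(ComplexTorus (Ψ x), ComplexPoints (fiberOver f x.1))) (hu : ∀ x, Function.Bijective (u x))
    (γ : ∀ x : W, ι → singularCohomology ℚ ℚ (ComplexPoints (fiberOver f x.1)) 1)
    (hγ : ∀ (x x' : W) (q : Path.Homotopic.Quotient x x') (a : ι),
      transportFun f 1 hU q (ofRatClass _ 1 (γ x a)) = ofRatClass _ 1 (γ x' a))
    (hframe : ∀ (x : W) (a : ι), singularCohomology.map ℚ ℚ (u x) 1 (γ x a) = latticeClass (Ψ x) a)
    (N : ℕ) (hN : 0 < N) (nX : 𝒳 ⟶ 𝒳) (hnX : nX ≫ f = f)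
    (hpow : ∀ (x : W) (t : ComplexTorus (Ψ x)),
      AlgPoints.map nX (AlgPoints.map (fiberι f x.1) (u x t)) = AlgPoints.map (fiberι f x.1) (u x (N • t)))
    (τ : W → ComplexPoints 𝒳) (hτ : Continuous τ) (w : W → ι → ℤ)
    (hτw : ∀ x, τ x = AlgPoints.map (fiberι f x.1) (u x (ComplexTorus.proj (Ψ x) fun i ↦ (w x i : ℝ) / N)))
    (x x' : W) (a : ι) : (w x a : ZMod N) = (w x' a : ZMod N) :=
  torsionReading_const_of_flatFrame f d m hW hU (Ψ x)
    (fun y ↦ (u y : C(ComplexTorus (Ψ x), ComplexPoints (fiberOver f y.1)))) hu γ hγ hframe N hN nX hnX hpow τ hτ w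
    hτw x x' a

end Main

end Literature.AlgebraicGeometry.HodgeTheory

end
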